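import Mathlib.AlgebraicGeometry.EllipticCurve.Affine.Point
import Mathlib.FieldTheory.IntermediateField.Adjoin.Basic
import Mathlib.FieldTheory.Minpoly.Field
import Mathlib.LinearAlgebra.Dimension.Free
import Literature.NumberTheory.Automorphic.X0FifteenOddDegreePoints
import HarnessLib

/-!
# Yoshikawa 2022, Corollary 3.3 (1), proved: `X(s3, b5)` acquires no new points over an
# odd-degree extension when `X₀(15)` does not

Topic `Literature/NumberTheory/Automorphic`; sibling PROOFS file of `X0FifteenOddDegreePoints.lean`.
It discharges the named fact

* `Literature.NumberTheory.Automorphic.Yoshikawa2022_corollary3_3_1` —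
  `Literature.NumberTheory.Automorphic.Yoshikawa2022_corollary3_3_1_holds`:
  for fields `F ⊆ F'` of characteristic `0` with `[F' : F]` finite and odd, if every affine
  `F'`-point of 15A1 `= [1, 1, 1, -10, -10]` (`= X₀(15)`) has both coordinates in `F`, then so does
  every affine `F'`-point of 15A3 `= [1, 1, 1, -5, 2]` (`= X(s3, b5)`).

Source: S. Yoshikawa, *Modularity of elliptic curves over cyclotomic `ℤ_p`-extensions of real
quadratic fields*, arXiv:2206.12860 (2022), §3 (pp. 4–5 of the held text): Lemma 3.1 (2) ("There
is an isogeny `X(s3, b5) → X₀(15)` of degree 2 over `ℚ`"), Lemma 3.2 (a degree-`2` cover acquires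
no new points over an odd-degree extension if the base curve does not: "`P` is defined over some
`F''/F` with `[F'' : F] ≤ 2`; `[F' : F]` odd gives `F' ∩ F'' = F`"), Corollary 3.3 (1)
("immediate consequence of Lemma 3.1 (2), (4), and Lemma 3.2").

## Proof (the printed one, with the isogeny made explicit; pure algebra, no new facts)

* `mem_range_of_quadratic` (**Lemma 3.2, algebraic core**): a root `α ∈ F'` of a quadratic
  `T² + bT + c ∈ F[T]` lies in `F`, because `[F(α) : F] = deg minpoly_F(α) ≤ 2` divides the odd
  `[F' : F]` (Mathlib `IntermediateField.adjoin.finrank`, `Module.finrank_mul_finrank`,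
  `minpoly.mem_range_of_degree_eq_one`).
* **The isogeny of Lemma 3.1 (2)**: in the coordinates `X = 4x - 4`, `Y = 8y + 4x + 4` the curve
  15A3 is the Legendre model `Y² = X(X + 1)(X + 16)` of `X(s3, b5)` (rational `2`-torsion at
  `X = 0, -1, -16`), and `(X, Y) ↦ (u, v) = (Y²/X² - 25, Y(16 - X²)/X²)` (Vélu, kernel `(0, 0)`)
  satisfies `v² = u(u + 16)(u + 25)` — the Legendre model of `X₀(15)`, which is 15A1 in the
  coordinates `u = 4x₁ - 12`, `v = 8y₁ + 4x₁ + 4` (cf. `Thorne2019.variableChange_E₁`,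
  `ThorneQInfinityModular.lean`). So the hypothesis gives `u ∈ F`; `X` is a root of
  `T² - (u + 8)T + 16` and then `Y` a root of `T² - X(X + 1)(X + 16)`, both over `F`, hence
  `X, Y ∈ F` and `x = (X + 4)/4`, `y = (Y - X - 8)/8 ∈ F`; the kernel point `X = 0` is `(1, -1)`.
  (Same identities as in `ThorneQInfinityModularRationalPointsProofs.lean`, there over `ℚ`.)

## References

* [Yoshikawa2022] S. Yoshikawa, arXiv:2206.12860, Lemma 3.1 (2), Lemma 3.2, Cor. 3.3 (1)
  (pp. 4–5 of the held text).
* [Thorne2019] J. A. Thorne, J. Eur. Math. Soc. 21 (2019), Prop. 4 (the two Cremona models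
  15A1, 15A3 "related by an isogeny of degree 2").

## Design

Theorems only (no definitions, no new named facts); the curves are written literally, as in the
fact. No group law is used. `#print axioms Yoshikawa2022_corollary3_3_1_holds`: `propext`,
`Classical.choice`, `Quot.sound`.
-/

noncomputable section

open Polynomial WeierstrassCurve WeierstrassCurve.Affine

open scoped IntermediateField

namespace Literature.NumberTheory.Automorphic

namespace Yoshikawa2022

/-! ### Lemma 3.2, algebraic core: a root of a quadratic descends along an odd-degree extension -/

/-- **A root in `F'` of a quadratic over `F` lies in `F` when `[F' : F]` is odd** (the degree
argument of Yoshikawa 2022, Lemma 3.2: "`P` is defined over `F''/F` with `[F'' : F] ≤ 2` …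
`[F' : F]` odd"): if `α² + bα + c = 0` with `b, c ∈ F` then `α ∈ F`. Proof: the minimal polynomial
of `α` divides `X² + bX + c`, so `[F(α) : F] = deg ≤ 2`, and it divides the odd `[F' : F]`.
[cite: Yoshikawa2022, Lemma 3.2 (proof)] -/
theorem mem_range_of_quadratic {F F' : Type*} [Field F] [Field F'] [Algebra F F']
    [FiniteDimensional F F'] (hodd : Odd (Module.finrank F F')) {α : F'} {b c : F}
    (hα : α ^ 2 + algebraMap F F' b * α + algebraMap F F' c = 0) :
    α ∈ Set.range (algebraMap F F') := by
  have hint : IsIntegral F α := IsIntegral.of_finite F α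
  -- `minpoly F α ∣ X² + bX + c`, a monic quadratic
  set p : F[X] := X ^ 2 + C b * X + C c with hp
  have hp2 : p.natDegree = 2 := by
    rw [hp]
    compute_degree!
  have hp0 : p ≠ 0 := by
    intro h0
    rw [h0, natDegree_zero] at hp2
    exact two_ne_zero hp2.symm
  have hdvd : minpoly F α ∣ p := minpoly.dvd F α (by
    simp only [hp, map_add, map_mul, map_pow, aeval_X, aeval_C]
    exact hα)
  have hle : (minpoly F α).natDegree ≤ 2 := hp2 ▸ natDegree_le_of_dvd hdvd hp0
  -- `[F(α) : F] = deg (minpoly)` divides `[F' : F]`, which is odd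
  have hfin : Module.finrank F F⟮α⟯ = (minpoly F α).natDegree := IntermediateField.adjoin.finrank hint
  have hdvd' : (minpoly F α).natDegree ∣ Module.finrank F F' := by
    rw [← hfin]
    exact Dvd.intro _ (Module.finrank_mul_finrank F F⟮α⟯ F')
  have hodd' : Odd (minpoly F α).natDegree := hodd.of_dvd_nat hdvd'
  have hpos : 0 < (minpoly F α).natDegree := minpoly.natDegree_pos hint
  -- so the degree is `1`
  have h1 : (minpoly F α).natDegree = 1 := by
    obtain ⟨k, hk⟩ := hodd'
    omega
  have hdeg : (minpoly F α).degree = 1 := by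
    rw [degree_eq_natDegree (minpoly.ne_zero hint), h1]
    rfl
  obtain ⟨a, ha⟩ := minpoly.mem_range_of_degree_eq_one F α hdeg
  exact ⟨a, ha⟩

/-! ### The two Cremona models over an extension field -/

section Models

variable {F' : Type*} [Field F'] [CharZero F']

/-- The equation of `15A1 ⊗ F'`: `y² + xy + y = x³ + x² - 10x - 10`. [folklore] -/
theorem equation_fifteenA1_iff (x y : F') :
    ((⟨1, 1, 1, -10, -10⟩ : WeierstrassCurve ℚ).baseChange F').toAffine.Equation x y ↔
      y ^ 2 + x * y + y = x ^ 3 + x ^ 2 - 10 * x - 10 := by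
  rw [equation_iff]
  simp only [WeierstrassCurve.baseChange, WeierstrassCurve.map, map_one, map_neg, map_ofNat]
  constructor <;> intro h <;> linear_combination h

/-- The equation of `15A3 ⊗ F'`: `y² + xy + y = x³ + x² - 5x + 2`. [folklore] -/
theorem equation_fifteenA3_iff (x y : F') :
    ((⟨1, 1, 1, -5, 2⟩ : WeierstrassCurve ℚ).baseChange F').toAffine.Equation x y ↔
      y ^ 2 + x * y + y = x ^ 3 + x ^ 2 - 5 * x + 2 := by
  rw [equation_iff]
  simp only [WeierstrassCurve.baseChange, WeierstrassCurve.map, map_one, map_neg, map_ofNat]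
  constructor <;> intro h <;> linear_combination h

/-- `15A1 ⊗ F'` is an elliptic curve in characteristic `0` (`Δ = 50625 = 3⁴·5⁴`), so every point
on it is nonsingular. [folklore] -/
theorem nonsingular_fifteenA1_of_equation {x y : F'}
    (h : ((⟨1, 1, 1, -10, -10⟩ : WeierstrassCurve ℚ).baseChange F').toAffine.Equation x y) :
    ((⟨1, 1, 1, -10, -10⟩ : WeierstrassCurve ℚ).baseChange F').toAffine.Nonsingular x y := by
  refine (equation_iff_nonsingular_of_Δ_ne_zero ?_).mp h
  rw [WeierstrassCurve.baseChange, map_Δ,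
    show (⟨1, 1, 1, -10, -10⟩ : WeierstrassCurve ℚ).Δ = 50625 by
      norm_num [WeierstrassCurve.Δ, WeierstrassCurve.b₂, WeierstrassCurve.b₄, WeierstrassCurve.b₆,
        WeierstrassCurve.b₈], map_ofNat]
  norm_num

end Models

/-! ### Corollary 3.3 (1) -/

/-- **Yoshikawa 2022, Corollary 3.3 (1), proved**: discharge of the named fact
`Yoshikawa2022_corollary3_3_1` — over an odd-degree extension `F'/F` of fields of characteristic
`0`, if every `F'`-point of 15A1 `= X₀(15)` has coordinates in `F` then so does every `F'`-point
of 15A3 `= X(s3, b5)`. Proof (Yoshikawa's: Lemma 3.1 (2), the degree-`2` isogeny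
`X(s3, b5) → X₀(15)`, made explicit, and Lemma 3.2): in the coordinates `X = 4x - 4`,
`Y = 8y + 4x + 4` the curve 15A3 is the Legendre model `Y² = X(X + 1)(X + 16)`, and for `X ≠ 0`
the isogeny `(X, Y) ↦ (u, v) = (Y²/X² - 25, Y(16 - X²)/X²)` with kernel `(0, 0)` lands on the
Legendre model `v² = u(u + 16)(u + 25)` of `X₀(15)`, which is 15A1 in the coordinates
`u = 4x₁ - 12`, `v = 8y₁ + 4x₁ + 4`; by hypothesis `u ∈ F`; then `X` is a root of
`T² - (u + 8)T + 16 ∈ F[T]` and `Y` a root of `T² - X(X + 1)(X + 16)`, so both lie in `F` by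
`mem_range_of_quadratic`, whence `x = (X + 4)/4`, `y = (Y - X - 8)/8 ∈ F` (and `X = 0` is the
rational point `(1, -1)`). [cite: Yoshikawa2022, Cor. 3.3 (1), Lemma 3.1 (2), Lemma 3.2] -/
theorem _root_.Literature.NumberTheory.Automorphic.Yoshikawa2022_corollary3_3_1_holds :
    Yoshikawa2022_corollary3_3_1 := by
  intro F F' _ _ _ _ _ _ hodd h1 x y hxy
  have hxy' := (equation_fifteenA3_iff x y).mp hxy.1
  -- Legendre coordinates on 15A3
  have hL : (8 * y + 4 * x + 4) ^ 2 = (4 * x - 4) * ((4 * x - 4) + 1) * ((4 * x - 4) + 16) := by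
    linear_combination 64 * hxy'
  by_cases hX : 4 * x - 4 = 0
  · -- the kernel point `(1, -1)`
    have hx : x = 1 := by linear_combination hX / 4
    subst hx
    have h0 : (8 * (y + 1)) ^ 2 = 0 := by linear_combination hL
    have hy : y = -1 := by
      have := (pow_eq_zero_iff two_ne_zero).mp h0
      linear_combination this / 8
    subst hy
    exact ⟨⟨1, map_one _⟩, ⟨-1, by rw [map_neg, map_one]⟩⟩
  -- `X ≠ 0`: the isogenous point `(u, v)` on `v² = u(u + 16)(u + 25)`
  set X := 4 * x - 4 with hXdef
  set Y := 8 * y + 4 * x + 4 with hYdef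
  have hX2 : X ^ 2 ≠ 0 := pow_ne_zero 2 hX
  have hiso : X ^ 2 * Y ^ 2 * (16 - X ^ 2) ^ 2 =
      (Y ^ 2 - 25 * X ^ 2) * (Y ^ 2 - 9 * X ^ 2) * Y ^ 2 := by
    linear_combination (-(Y ^ 2) * (2 * X ^ 3 + 32 * X + Y ^ 2 - X * (X + 1) * (X + 16))) * hL
  set u := Y ^ 2 / X ^ 2 - 25 with hudef
  set v := Y * (16 - X ^ 2) / X ^ 2 with hvdef
  have huv : v ^ 2 = u * (u + 16) * (u + 25) := by
    rw [hudef, hvdef]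
    field_simp
    linear_combination hiso
  -- `((u + 12)/4, (v - u - 16)/8)` is an `F'`-point of 15A1, hence has coordinates in `F`
  have hE₁ : ((⟨1, 1, 1, -10, -10⟩ : WeierstrassCurve ℚ).baseChange F').toAffine.Equation
      ((u + 12) / 4) ((v - u - 16) / 8) := by
    rw [equation_fifteenA1_iff]
    linear_combination huv / 64
  obtain ⟨⟨a, ha⟩, -⟩ := h1 _ _ (nonsingular_fifteenA1_of_equation hE₁)
  have hu : u = algebraMap F F' (4 * a - 12) := by
    rw [map_sub, map_mul, map_ofNat, map_ofNat, ha]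
    ring
  -- `X` is a root of `T² - (u + 8)T + 16`, so `X ∈ F`
  have hquad : X ^ 2 + algebraMap F F' (-(4 * a - 12) - 8) * X + algebraMap F F' 16 = 0 := by
    have hu' : Y ^ 2 = (u + 25) * X ^ 2 := by
      rw [hudef]
      field_simp
      ring
    have h1' : X * (X ^ 2 - (u + 8) * X + 16) = 0 := by linear_combination hu' - hL
    have h2' := (mul_eq_zero.mp h1').resolve_left hX
    rw [map_sub, map_neg, map_ofNat, map_ofNat, ← hu]
    linear_combination h2'
  obtain ⟨X₀, hX₀⟩ := mem_range_of_quadratic hodd hquad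
  -- `Y` is a root of `T² - X(X + 1)(X + 16)`, so `Y ∈ F`
  have hquadY : Y ^ 2 + algebraMap F F' 0 * Y + algebraMap F F' (-(X₀ * (X₀ + 1) * (X₀ + 16))) =
      0 := by
    rw [map_zero, map_neg, map_mul, map_mul, map_add, map_add, map_one, map_ofNat, hX₀]
    linear_combination hL
  obtain ⟨Y₀, hY₀⟩ := mem_range_of_quadratic hodd hquadY
  -- back to `(x, y)`
  refine ⟨⟨(X₀ + 4) / 4, ?_⟩, ⟨(Y₀ - X₀ - 8) / 8, ?_⟩⟩
  · rw [map_div₀, map_add, map_ofNat, hX₀, hXdef]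
    ring
  · rw [map_div₀, map_sub, map_sub, map_ofNat, hX₀, hY₀, hYdef, hXdef]
    ring

end Yoshikawa2022

end Literature.NumberTheory.Automorphic

end
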